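import Literature.NumberTheory.EllipticCurves.Sprung2012.ColemanMapLevelCongruenceProofs
import Literature.NumberTheory.EllipticCurves.Sprung2012.LocalIwasawaModule
import Literature.NumberTheory.EllipticCurves.IwasawaAlgebraProofs
import HarnessLib

/-!
# Sprung 2012 §§2, 5, 7: the COKERNEL of the joint Coleman map `Col = (Col♯, Col♭) : H¹_Iw(T) → Λ ⊕ Λ` —
# `T·Λ² ⊆ Col(H¹_Iw(T))` from levels `0, 1, 2` of the Coleman characterisation, modulo ONE point-independence clause
# (proofs only, in the tree's transcription `ColemanMaps.lean`)

Topic `Literature/NumberTheory/EllipticCurves`, cluster `Sprung2012` (namespace = path). A THEOREMS file (no definition, no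
named fact; net Literature debt `0`). Cell `bsd-ssimc`, width seat `cruxlead-stmt-BirchSwinnertonDyer-19875-w2` (gen 8), in
support of the x8 cruxes stmt-BirchSwinnertonDyer-22569 `KatoFineLowerSporadicX8` / 22901 `CyclotomicLowerPosLevelX8` through
the COKERNEL BOUND F-α of the ledger doors: the skeleton
`Summits/…/Theorems/SignedLowerHalvesSprungLowerDivisibilityAtThreeCokerBoundSkeleton.lean`
(`min_lengthAt_quotient_range_le_lengthAt_torsion_of_skeleton`, w3 g6) needs the joint Coleman map `J : P → Λ²` INJECTIVE
(`Sprung2012/ColemanMapJointInjectiveProofs.lean`, w3 g6) with cokernel of length `0` at the height-one prime `𝔭 ∌ T`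
(its hypothesis `hcoker`). In print this is the exact sequence (SES-KP) `0 → H¹_Iw(ℚ_p, T) → Λ² → ℤ_p → 0` — Kurihara–Pollack
2007 Prop. 1.2 for `a_p = 0`; for `a_p ≠ 0` only Lei–Sujatha 2021 §3 «as given by [KP] and [Sprung]», F. E. I. Sprung,
*Iwasawa theory for elliptic curves at supersingular primes: A pair of main conjectures*, J. Number Theory **132** (2012)
[Sprung2012] printing the INDIVIDUAL surjectivities Props. 7.3/7.6 (p. 1500–1501) only (x8 lit T63 (c1): «prove in-tree
rather than cite»). THIS FILE proves the cokernel half in the tree's functional model (`H¹_Iw(T)` = additive functionals on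
`E(K_∞·K_v)`, `Col(z) = (L♯, L♭)` iff `IsColemanPair`, `Λ` acting by `lambdaSMul`), MODULO ONE EXPLICIT CLAUSE on two
points of the Honda system — and isolates that clause as exactly the input the tree's `IsHondaSystem` cannot supply.

## The mathematics (levels `0, 1, 2` of Def. 5.9 read modulo `(p, T²)`)

For a functional `z` with `Col(z) = (a, b)` attached to a Honda system `(c_{−1}, c)` (`p ∣ a_p`), write `ℓ(z) = z(c_{−1})`,
`σ₁(z) = ∑_{j<p} j·z(gʲc_1)`, `σ₂(z) = ∑_{j<p²} C(j,p)·z(gʲc_2)`, `τ = σ₂ − 2σ₁`.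
* Level `0` (`Col♭_0 = −P_{0,c_0}`) and level `1` (`Col♯_1 = −P_{1,c_1}`; Def. 7.2) with the Honda relations
  `c_0 = (a_p−2)c_{−1}`, `Tr_{1/0}c_1 = a_p c_0 − (p−1)c_{−1}` (Thm. 2.2): `a(0) = −(a_p(a_p−2) − (p−1))·ℓ(z)`,
  `b(0) = −(a_p−2)·ℓ(z)` — so **`Col(H¹_Iw) mod T` is the LINE `ℤ_p·(a_p(a_p−2)−(p−1), a_p−2) ≡ ℤ_p·(1, −2)`**
  (`IsColemanPair.constantCoeff_eq`; the sanity note of `ColemanMapImage.lean`);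
* level `1` modulo `(p, T²)` (`ω_1 ≡ T^p`): `a'(0) ≡ −σ₁(z)` (`…natCast_dvd_coeff_one_sharp_add`);
* level `2` (`ω_2 ∣ P_{2,c_2}(z) + u_2 a + v_2 b`, `u_2 = a_p`, `v_2 = −Φ_p(1+T) ≡ −T^{p−1}`, `ω_2 ≡ T^{p²}`; Sprung 2017
  Cor. 4.4): `b'(0) ≡ σ₂(z)` (`…natCast_dvd_coeff_one_flat_sub`).
Hence for two functionals `z₀, z₁` the WRONSKIAN `D = a₀b₁ − b₀a₁` of their Coleman values has `D(0) = 0` and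
`D'(0) ≡ ℓ(z₁)τ(z₀) − ℓ(z₀)τ(z₁) (mod p)` (`IsColemanPair.wronskian_constantCoeff_eq_zero_and_dvd`), where
`τ(z) = z(q)` for the POINT `q = ∑_{j<p²} C(j,p)·gʲc_2 − 2·∑_{j<p} j·gʲc_1 ∈ E(K_2·K_v)` (`evalOn_honda_q`). If this `2 × 2`
determinant is a `p`-adic unit, `D = T·(unit of Λ)` and Cramer's rule with the `Λ`-linearity of `Col`
(`isColemanPair_lambdaSMul`, Def. 5.9) gives **every `(T·x, T·y)` as a Coleman value**
(`IsColemanPair.forall_exists_isColemanPair_X_mul_of_det`). By TWO-POINT Pontryagin separation on the `p`-torsion-free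
tower (Lemma 2.3; `exists_addMonoidHom_pair_det_not_dvd`, from the one-point lemma of
`Literature/Algebra/Module/PadicFunctionalSeparation.lean`) such `z₀, z₁` exist as soon as
**(IND) `c_{−1}` and `q` are `𝔽_p`-independent in `E(K_∞·K_v)/p`** (`forall_exists_isColemanPair_X_mul_of_independent`,
`…_rat`). Finally §5 turns «`T·Λ² ⊆ range J`» into the skeleton's `hcoker`: `ℓ_𝔭(Λ²/range J) = 0` at every prime `𝔭 ∌ T`
(`lengthAt_quotient_range_eq_zero_of_forall_X_mul`). The three level congruences are part 1,
`Sprung2012/ColemanMapLevelCongruenceProofs.lean`.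

## HONEST FRAMING — the residual clause (IND)

(IND) is TRUE for every Honda system of an elliptic curve at an odd supersingular prime: the generation clauses of
`IsHondaSystem` at level `2` (dual form of «`c_2, c_1` generate `Ê(𝔪_2)` over `ℤ_p[Γ_2]`», Thm. 2.2 / Cor. 2.10) say that the
`ℤ_p`-span of the Honda orbit is the formal-group part of `E(ℚ_{p,2})`, FREE OF RANK `p² = [ℚ_{p,2} : ℚ_p]` (Lemma 2.3), so
modulo `p` the orbit spans a `p²`-dimensional `𝔽_p[N]`-module (`N = g − 1`, `N^{p²−p}c̄_2 = 2c̄_{−1} = 2N^{p−1}c̄_1`,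
`⟨c̄_2⟩ ∩ ⟨c̄_1⟩ = 𝔽_p c̄_{−1}`), in which `q̄ − 2c̄_{−1} = 2N^{p−2}c̄_1 − N^{p²−p−1}c̄_2` is a second socle vector
(`Σ_{j<p²} C(j,p)(1+N)ʲ ≡ −N^{p²−p−1} − N^{p²−1}`, `Σ_{j<p} j(1+N)ʲ ≡ −N^{p−2} − N^{p−1}` mod `p`). But the RANK of
`E(K_2·K_v) ⊗ ℤ_p` is NOT part of the tree's predicate `IsHondaSystem` (its dual clauses give generation, never rank), nor
anywhere else in the tree; so (IND) is displayed as a hypothesis. A typed fact «`Ê(𝔪_n)` is `ℤ_p`-free of rank `pⁿ`»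
(Lemma 2.3 / Lutz–Mattuck) plus the nilpotent-operator computation above discharges it. NOTHING in this file needs `p` odd or
`K = ℚ` except the `p`-torsion-freeness of the tower, a theorem over `ℚ` (`LocalTowerNoPTorsionProofs`); `κ.IsCyclotomic` is
not used. Nothing about any curve's Selmer group, the ♯/♭ main conjecture or BSD is asserted or proved here.

## Contents
* §0 «`D(0) = 0 ∧ p ∤ D'(0) ⟹ D = T·unit`» in `Λ`; §1 the Wronskian and the CRITERION; §2 two-point separation; §3 the
  cokernel clause from (IND) (any base field, any `ℤ_p`-extension, any place); §4 over `ℚ` (Lemma 2.3 discharged); §5 the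
  consumer's form `ℓ_𝔭(Λ²/range J) = 0` off `(T)`. Part 1 (`ColemanMapLevelCongruenceProofs`): the level congruences.

## References
* [Sprung2012] F. E. I. Sprung, J. Number Theory 132 (2012) 1483–1506: Thm. 2.2, Lemma 2.3, Cor. 2.10 (pp. 1487–1489); Def. 3.1
  (p. 1489); Prop. 5.5, Prop. 5.7, Def. 5.9 (pp. 1494–1495); Def. 7.1–7.2, Prop. 7.3, Lemmas 7.4–7.5 (p. 1500); Prop. 7.6
  (p. 1501); Lemma 7.10 (p. 1503).
* [Sprung2017] F. Sprung, ANT 11 (2017), §4 Cor. 4.4 (`u_2 = a_p`, `v_2 = −Φ_p(1+T)`).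
* [KuriharaPollack2007] M. Kurihara, R. Pollack, Prop. 1.2 (the `a_p = 0` sequence). [LeiSujatha2021] A. Lei, R. Sujatha, §3 (SES-KP).
* [Pollack2003] R. Pollack, Duke Math. J. 118, Thm. 6.17 (`ω_n`). [NeukirchSchmidtWingberg2008] I §1 (1.1.8) (Pontryagin duality).
* Tree: `Sprung2012/{ColemanMaps, ColemanMapLevelCongruenceProofs (part 1), ColemanMapSurjectiveProofs,
  ColemanMapJointInjectiveProofs, LocalIwasawaModule,
  ColemanTwistProofs (IsColemanPair.add), ColemanPairExistsProofs (exists_isColemanPair), LocalTowerNoPTorsionProofs}.lean`,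
  `Sprung2024/ChromaticSmallControlSurjProofs` (`constantCoeff_pairingSum`), `PlusMinusPAdicLFunctionProofs`
  (`cyclotomicOmega_succ`), `Algebra/Module/PadicFunctionalSeparation`, `IwasawaAlgebraProofs` (`lengthAt_eq_zero_of_isTorsionBy`).
-/

noncomputable section

open scoped Classical NumberField

open Polynomial Finset

universe u

namespace Literature.NumberTheory.EllipticCurves.Sprung2012

open Literature.NumberTheory.EllipticCurves Literature.NumberTheory.GaloisRepresentations ZpExtension
  Literature.NumberTheory.EllipticCurves.Kobayashi2003 Literature.NumberTheory.EllipticCurves.Sprung2017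

/-! ## §0 Two facts about `Λ = ℤ_p⟦T⟧` -/

section Coeff

variable {p : ℕ} [Fact p.Prime]

/-- Units of `ℤ_p` are the elements not divisible by `p`. [folklore] -/
private theorem padicInt_isUnit_iff_not_dvd {a : ℤ_[p]} : IsUnit a ↔ ¬ (p : ℤ_[p]) ∣ a := by
  rw [PadicInt.isUnit_iff, ← PadicInt.norm_lt_one_iff_dvd, not_lt, le_antisymm_iff,
    and_iff_right (PadicInt.norm_le_one a)]

/-- **A power series `D ∈ Λ` with `D(0) = 0` and `p ∤ D'(0)` is `T` times a unit.** [folklore] -/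
private theorem exists_eq_X_mul_unit_of_constantCoeff_eq_zero {D : IwasawaAlgebra p} (h0 : PowerSeries.constantCoeff D = 0)
    (h1 : ¬ (p : ℤ_[p]) ∣ PowerSeries.coeff 1 D) :
    ∃ u : (IwasawaAlgebra p)ˣ, D = PowerSeries.X * (u : IwasawaAlgebra p) := by
  obtain ⟨D', hD'⟩ := PowerSeries.X_dvd_iff.mpr h0
  have hu : IsUnit D' := by
    rw [PowerSeries.isUnit_iff_constantCoeff, padicInt_isUnit_iff_not_dvd, ← PowerSeries.coeff_zero_eq_constantCoeff_apply,
      ← PowerSeries.coeff_succ_X_mul 0 D', ← hD']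
    exact h1
  obtain ⟨u, rfl⟩ := hu
  exact ⟨u, hD'⟩

end Coeff

section Local

variable {K : Type u} [Field K] {p : ℕ} [Fact p.Prime] (κ : ZpExtension K p)
variable {E : Type u} [Field E] [Algebra K E] (ι : AlgebraicClosure K →ₐ[K] AlgebraicClosure E)
variable (W : WeierstrassCurve K)

variable {κ ι W}

/-! ## §1 Two functionals: the Wronskian `D = L♯(z₀)L♭(z₁) − L♭(z₀)L♯(z₁)` modulo `(p, T²)` and the criterion -/

/-- `coeff_1 (φ ψ) = φ₀ ψ₁ + φ₁ ψ₀`. [folklore] -/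
private theorem coeff_one_mul' (φ ψ : IwasawaAlgebra p) :
    PowerSeries.coeff 1 (φ * ψ) =
      PowerSeries.constantCoeff φ * PowerSeries.coeff 1 ψ + PowerSeries.coeff 1 φ * PowerSeries.constantCoeff ψ := by
  rw [PowerSeries.coeff_mul, Nat.sum_antidiagonal_eq_sum_range_succ (fun i j => PowerSeries.coeff i φ * PowerSeries.coeff j ψ) 1,
    sum_range_succ, sum_range_one, Nat.sub_zero, Nat.sub_self, PowerSeries.coeff_zero_eq_constantCoeff_apply,
    PowerSeries.coeff_zero_eq_constantCoeff_apply]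

/-- **The Wronskian of two Coleman values vanishes at `T = 0` and its linear term is, modulo `p`, the `2 × 2` determinant
`z₁(c_{−1})·z₀(q) − z₀(c_{−1})·z₁(q)`**, where `z(q) = ∑_{j<p²} C(j,p) z(gʲc_2) − 2∑_{j<p} j z(gʲc_1)` (the value at the point
`q = ∑_{j<p²} C(j,p) gʲc_2 − 2∑_{j<p} j gʲc_1 ∈ E(K_2·K_v)`). For `Col(z₀) = (α, β)`, `Col(z₁) = (a, b)` and `D = αb − βa`:
`D(0) = 0` (both `(α(0), β(0))` and `(a(0), b(0))` lie on the line `ℤ_p·(a_p(a_p−2)−(p−1), a_p−2)`), and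
`D'(0) ≡ z₁(c_{−1})·z₀(q) − z₀(c_{−1})·z₁(q) (mod p)` by the level-`1`/level-`2` congruences (`a_p ≡ 0`, so the line's
direction is `≡ (1, −2)`). [cite: Sprung2012, Def. 5.9 (p. 1495), Def. 7.2 (p. 1500), Thm. 2.2 (p. 1487)] -/
theorem IsColemanPair.wronskian_constantCoeff_eq_zero_and_dvd {ap : ℤ} (hap : (p : ℤ) ∣ ap) {g : Field.absoluteGaloisGroup E}
    (hg : κ.IsTopGenerator (resGalOfEmb ι g)) {cneg : localPoints W E} {c : ℕ → localPoints W E}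
    (hH : IsHondaSystem κ ι W ap g cneg c) {z₀ z₁ : localTowerPointsOfEmb κ ι W →+ ℤ_[p]} {α β a b : IwasawaAlgebra p}
    (h₀ : IsColemanPair κ ι W ap g c z₀ α β) (h₁ : IsColemanPair κ ι W ap g c z₁ a b) :
    PowerSeries.constantCoeff (α * b - β * a) = 0 ∧
      (p : ℤ_[p]) ∣ PowerSeries.coeff 1 (α * b - β * a) -
        (evalOn W (localTowerPointsOfEmb κ ι W) z₁ cneg *
            (∑ j ∈ range (p ^ 2), (j.choose p : ℤ_[p]) * evalOn W (localTowerPointsOfEmb κ ι W) z₀ (g ^ j • c 2) -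
              2 * ∑ j ∈ range p, (j : ℤ_[p]) * evalOn W (localTowerPointsOfEmb κ ι W) z₀ (g ^ j • c 1)) -
          evalOn W (localTowerPointsOfEmb κ ι W) z₀ cneg *
            (∑ j ∈ range (p ^ 2), (j.choose p : ℤ_[p]) * evalOn W (localTowerPointsOfEmb κ ι W) z₁ (g ^ j • c 2) -
              2 * ∑ j ∈ range p, (j : ℤ_[p]) * evalOn W (localTowerPointsOfEmb κ ι W) z₁ (g ^ j • c 1))) := by
  obtain ⟨hα0, hβ0⟩ := h₀.constantCoeff_eq hg hH
  obtain ⟨ha0, hb0⟩ := h₁.constantCoeff_eq hg hH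
  obtain ⟨xα, hxα⟩ := h₀.natCast_dvd_coeff_one_sharp_add
  obtain ⟨xa, hxa⟩ := h₁.natCast_dvd_coeff_one_sharp_add
  obtain ⟨yβ, hyβ⟩ := h₀.natCast_dvd_coeff_one_flat_sub hap
  obtain ⟨yb, hyb⟩ := h₁.natCast_dvd_coeff_one_flat_sub hap
  obtain ⟨b', hb'⟩ := hap
  -- abbreviations
  set ℓ₀ := evalOn W (localTowerPointsOfEmb κ ι W) z₀ cneg
  set ℓ₁ := evalOn W (localTowerPointsOfEmb κ ι W) z₁ cneg
  set σ₁₀ := ∑ j ∈ range p, (j : ℤ_[p]) * evalOn W (localTowerPointsOfEmb κ ι W) z₀ (g ^ j • c 1)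
  set σ₁₁ := ∑ j ∈ range p, (j : ℤ_[p]) * evalOn W (localTowerPointsOfEmb κ ι W) z₁ (g ^ j • c 1)
  set σ₂₀ := ∑ j ∈ range (p ^ 2), (j.choose p : ℤ_[p]) * evalOn W (localTowerPointsOfEmb κ ι W) z₀ (g ^ j • c 2)
  set σ₂₁ := ∑ j ∈ range (p ^ 2), (j.choose p : ℤ_[p]) * evalOn W (localTowerPointsOfEmb κ ι W) z₁ (g ^ j • c 2)
  constructor
  · rw [map_sub, map_mul, map_mul, hα0, hβ0, ha0, hb0]
    ring
  · rw [map_sub, coeff_one_mul', coeff_one_mul', hα0, hβ0, ha0, hb0, eq_sub_of_add_eq hxα, eq_sub_of_add_eq hxa,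
      eq_add_of_sub_eq hyβ, eq_add_of_sub_eq hyb, hb']
    push_cast
    exact ⟨-( (p : ℤ_[p]) * b' - 2) * ℓ₁ * xα + ((p : ℤ_[p]) * b' - 2) * ℓ₀ * xa
        + ((p : ℤ_[p]) * b' * ((p : ℤ_[p]) * b' - 2) - ((p : ℤ_[p]) - 1)) * (ℓ₁ * yβ - ℓ₀ * yb)
        + b' * (ℓ₁ * σ₁₀ - ℓ₀ * σ₁₁) + (b' * ((p : ℤ_[p]) * b' - 2) - 1) * (ℓ₁ * σ₂₀ - ℓ₀ * σ₂₁), by ring⟩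

/-- **COKERNEL CRITERION.** If two functionals `z₀, z₁` on `E(K_∞·K_v)` (Coleman values `(α, β)`, `(a, b)`) have
`z₀(c_{−1})·z₁(q) − z₁(c_{−1})·z₀(q) ∈ ℤ_p^×` for the point `q = ∑_{j<p²} C(j,p) gʲc_2 − 2∑_{j<p} j gʲc_1` (values spelled
out as sums), then the Wronskian `αb − βa` is `T` times a UNIT of `Λ`, and consequently **every pair `(T·x, T·y) ∈ T·Λ²` is
a Coleman value**: `Col((u⁻¹(xb − ya))•z₀ + (u⁻¹(αy − βx))•z₁) = (Tx, Ty)` for the `Λ`-action `lambdaSMul` (Def. 5.9: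
`Col` is `Λ`-linear, `isColemanPair_lambdaSMul`). With the injectivity of the joint map (`IsColemanPair.eq_zero_of_pair_zero`)
and the line `Col(H¹_Iw) mod T = ℤ_p·(a_p(a_p−2)−(p−1), a_p−2)` (`IsColemanPair.constantCoeff_eq`), this is the exact
sequence `0 → H¹_Iw(T) → Λ² → ℤ_p → 0` of Kurihara–Pollack / Lei–Sujatha (SES-KP) in the tree's functional model: the
cokernel of `Col` is `Λ/(T)`, of length `0` at every height-one prime `𝔭 ≠ (T)`.
[cite: Sprung2012, Def. 5.9 (p. 1495), Def. 7.1–7.2 and Props. 7.3/7.6 (pp. 1500–1501)] [cite: KuriharaPollack2007, Prop. 1.2]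
[cite: LeiSujatha2021, §3 (SES-KP)] -/
theorem IsColemanPair.forall_exists_isColemanPair_X_mul_of_det {ap : ℤ} (hap : (p : ℤ) ∣ ap)
    {g : Field.absoluteGaloisGroup E} (hg : κ.IsTopGenerator (resGalOfEmb ι g)) {cneg : localPoints W E}
    {c : ℕ → localPoints W E} (hH : IsHondaSystem κ ι W ap g cneg c) {z₀ z₁ : localTowerPointsOfEmb κ ι W →+ ℤ_[p]}
    {α β a b : IwasawaAlgebra p} (h₀ : IsColemanPair κ ι W ap g c z₀ α β) (h₁ : IsColemanPair κ ι W ap g c z₁ a b)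
    (hdet : ¬ (p : ℤ_[p]) ∣
      evalOn W (localTowerPointsOfEmb κ ι W) z₀ cneg *
          (∑ j ∈ range (p ^ 2), (j.choose p : ℤ_[p]) * evalOn W (localTowerPointsOfEmb κ ι W) z₁ (g ^ j • c 2) -
            2 * ∑ j ∈ range p, (j : ℤ_[p]) * evalOn W (localTowerPointsOfEmb κ ι W) z₁ (g ^ j • c 1)) -
        evalOn W (localTowerPointsOfEmb κ ι W) z₁ cneg *
          (∑ j ∈ range (p ^ 2), (j.choose p : ℤ_[p]) * evalOn W (localTowerPointsOfEmb κ ι W) z₀ (g ^ j • c 2) -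
            2 * ∑ j ∈ range p, (j : ℤ_[p]) * evalOn W (localTowerPointsOfEmb κ ι W) z₀ (g ^ j • c 1))) :
    (∃ u : (IwasawaAlgebra p)ˣ, α * b - β * a = PowerSeries.X * (u : IwasawaAlgebra p)) ∧
      ∀ x y : IwasawaAlgebra p, ∃ z : localTowerPointsOfEmb κ ι W →+ ℤ_[p],
        IsColemanPair κ ι W ap g c z (PowerSeries.X * x) (PowerSeries.X * y) := by
  obtain ⟨hD0, hD1⟩ := h₀.wronskian_constantCoeff_eq_zero_and_dvd hap hg hH h₁
  have hD1' : ¬ (p : ℤ_[p]) ∣ PowerSeries.coeff 1 (α * b - β * a) := by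
    intro h
    apply hdet
    have := dvd_sub h hD1
    rw [sub_sub_cancel] at this
    rw [← dvd_neg]
    convert this using 1
    ring
  obtain ⟨u, hu⟩ := exists_eq_X_mul_unit_of_constantCoeff_eq_zero hD0 hD1'
  refine ⟨⟨u, hu⟩, fun x y => ?_⟩
  set v : IwasawaAlgebra p := ↑u⁻¹ with hv
  have hvu : v * (u : IwasawaAlgebra p) = 1 := by rw [hv, Units.inv_mul]
  refine ⟨lambdaSMul κ ι W hg (v * (x * b - y * a)) z₀ + lambdaSMul κ ι W hg (v * (α * y - β * x)) z₁, ?_⟩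
  have h := (isColemanPair_lambdaSMul hg hH.2.1 h₀ (v * (x * b - y * a))).add
    (isColemanPair_lambdaSMul hg hH.2.1 h₁ (v * (α * y - β * x)))
  have e1 : v * (x * b - y * a) * α + v * (α * y - β * x) * a = PowerSeries.X * x := by
    rw [show v * (x * b - y * a) * α + v * (α * y - β * x) * a = v * ((α * b - β * a) * x) by ring, hu,
      show v * (PowerSeries.X * ↑u * x) = (v * ↑u) * (PowerSeries.X * x) by ring, hvu, one_mul]
  have e2 : v * (x * b - y * a) * β + v * (α * y - β * x) * b = PowerSeries.X * y := by
    rw [show v * (x * b - y * a) * β + v * (α * y - β * x) * b = v * ((α * b - β * a) * y) by ring, hu,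
      show v * (PowerSeries.X * ↑u * y) = (v * ↑u) * (PowerSeries.X * y) by ring, hvu, one_mul]
  rwa [e1, e2] at h

end Local

/-! ## §2 Two-point Pontryagin separation: functionals with a unit `2 × 2` determinant from point independence mod `p` -/

section Separation

variable {p : ℕ} [Fact p.Prime] {N : Type*} [AddCommGroup N]

/-- **Two-point separation.** On a `p`-torsion-free abelian group `N`, if `x₁, x₂` are `𝔽_p`-independent modulo `p·N`
(`p·y = m₁x₁ + m₂x₂ ⟹ p ∣ m₁, m₂`), there are functionals `z, w : N →+ ℤ_p` with `z(x₁)w(x₂) − w(x₁)z(x₂) ∈ ℤ_p^×`.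
From the one-point lemma `Literature.Algebra.Module.exists_addMonoidHom_padicInt_not_dvd` (Pontryagin duality): take `z`
with `p ∤ z(x₁)`, integers `m_i ≡ z(x_i) (mod p)`, and `w` with `p ∤ w(m₁x₂ − m₂x₁)`. [folklore]
[cite: NeukirchSchmidtWingberg2008, I §1 (1.1.8)] -/
theorem exists_addMonoidHom_pair_det_not_dvd (hN : ∀ y : N, p • y = 0 → y = 0) {x₁ x₂ : N}
    (hind : ∀ (m₁ m₂ : ℤ) (y : N), p • y = m₁ • x₁ + m₂ • x₂ → (p : ℤ) ∣ m₁ ∧ (p : ℤ) ∣ m₂) :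
    ∃ z w : N →+ ℤ_[p], ¬ (p : ℤ_[p]) ∣ z x₁ * w x₂ - w x₁ * z x₂ := by
  have hp : p.Prime := Fact.out
  have hcast : ∀ m : ℕ, (p : ℤ) ∣ (m : ℤ) → (p : ℤ_[p]) ∣ (m : ℤ_[p]) := fun m h ↦ by
    obtain ⟨k, hk⟩ := h
    refine ⟨(k : ℤ_[p]), ?_⟩
    exact_mod_cast hk
  -- `x₁ ∉ p·N`
  have hx₁ : ∀ y : N, p ^ 1 • y ≠ x₁ := by
    intro y hy
    rw [pow_one] at hy
    have h := (hind 1 0 y (by rw [hy, one_zsmul, zero_zsmul, add_zero])).1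
    exact hp.one_lt.ne' (Nat.dvd_one.mp (Int.natCast_dvd_natCast.mp (by rwa [Nat.cast_one])))
  obtain ⟨z, hz⟩ := Literature.Algebra.Module.exists_addMonoidHom_padicInt_not_dvd hN hx₁
  rw [pow_one] at hz
  -- integers `m_i ≡ z(x_i) (mod p)`
  set m₁ : ℕ := (z x₁).appr 1 with hm₁def
  set m₂ : ℕ := (z x₂).appr 1 with hm₂def
  have hm₁ : (p : ℤ_[p]) ∣ z x₁ - m₁ := by
    have h := PadicInt.appr_spec 1 (z x₁)
    rw [pow_one] at h
    exact Ideal.mem_span_singleton.mp h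
  have hm₂ : (p : ℤ_[p]) ∣ z x₂ - m₂ := by
    have h := PadicInt.appr_spec 1 (z x₂)
    rw [pow_one] at h
    exact Ideal.mem_span_singleton.mp h
  -- `m₁x₂ − m₂x₁ ∉ p·N`
  have hx₂ : ∀ y : N, p ^ 1 • y ≠ (m₁ : ℤ) • x₂ - (m₂ : ℤ) • x₁ := by
    intro y hy
    rw [pow_one] at hy
    have h := (hind (-(m₂ : ℤ)) m₁ y (by rw [hy, neg_zsmul, sub_eq_neg_add])).2
    apply hz
    have e : z x₁ = (z x₁ - m₁) + m₁ := by ring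
    rw [e]
    exact dvd_add hm₁ (hcast m₁ h)
  obtain ⟨w, hw⟩ := Literature.Algebra.Module.exists_addMonoidHom_padicInt_not_dvd hN hx₂
  rw [pow_one, map_sub, map_zsmul, map_zsmul, zsmul_eq_mul, zsmul_eq_mul, Int.cast_natCast, Int.cast_natCast] at hw
  refine ⟨z, w, fun h => hw ?_⟩
  have e : (m₁ : ℤ_[p]) * w x₂ - (m₂ : ℤ_[p]) * w x₁ =
      (z x₁ * w x₂ - w x₁ * z x₂) - ((z x₁ - m₁) * w x₂ - w x₁ * (z x₂ - m₂)) := by ring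
  rw [e]
  exact dvd_sub h (dvd_sub (dvd_mul_of_dvd_left hm₁ _) (dvd_mul_of_dvd_right hm₂ _))

end Separation

/-! ## §3 The cokernel clause of (SES-KP) from ONE point-independence clause -/

section Cokernel

variable {K : Type u} [Field K] {p : ℕ} [Fact p.Prime] (κ : ZpExtension K p)
variable {E : Type u} [Field E] [Algebra K E] (ι : AlgebraicClosure K →ₐ[K] AlgebraicClosure E)
variable (W : WeierstrassCurve K)

variable {κ ι W}

/-- The point `q = ∑_{j<p²} C(j,p)·gʲc_2 − 2·∑_{j<p} j·gʲc_1` of the Honda span at level `2` lies in `E(K_∞·K_v)`.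
[cite: Sprung2012, Thm. 2.2 (p. 1487), Lemma 7.10 (p. 1503)] -/
theorem honda_q_mem {ap : ℤ} {g : Field.absoluteGaloisGroup E} {cneg : localPoints W E} {c : ℕ → localPoints W E}
    (hH : IsHondaSystem κ ι W ap g cneg c) :
    (∑ j ∈ range (p ^ 2), (j.choose p) • (g ^ j • c 2) - 2 • ∑ j ∈ range p, j • (g ^ j • c 1)) ∈
      localTowerPointsOfEmb κ ι W := by
  have hle := fun n ↦ localLayerPointsOfEmb_le_localTowerPointsOfEmb κ ι W n
  refine sub_mem (AddSubgroup.sum_mem _ fun j _ => AddSubgroup.nsmul_mem _ ?_ _)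
    (AddSubgroup.nsmul_mem _ (AddSubgroup.sum_mem _ fun j _ => AddSubgroup.nsmul_mem _ ?_ _) _)
  · exact smul_mem_localTowerPointsOfEmb κ ι W _ (hle 2 (hH.2.1 2))
  · exact smul_mem_localTowerPointsOfEmb κ ι W _ (hle 1 (hH.2.1 1))

/-- The value of a functional `z` on `E(K_∞·K_v)` at `q` is `∑_{j<p²} C(j,p) z(gʲc_2) − 2∑_{j<p} j z(gʲc_1)`.
[cite: Sprung2012, Def. 3.1 (p. 1489)] -/
theorem evalOn_honda_q {ap : ℤ} {g : Field.absoluteGaloisGroup E} {cneg : localPoints W E} {c : ℕ → localPoints W E}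
    (hH : IsHondaSystem κ ι W ap g cneg c) (z : localTowerPointsOfEmb κ ι W →+ ℤ_[p]) :
    evalOn W (localTowerPointsOfEmb κ ι W) z
        (∑ j ∈ range (p ^ 2), (j.choose p) • (g ^ j • c 2) - 2 • ∑ j ∈ range p, j • (g ^ j • c 1)) =
      ∑ j ∈ range (p ^ 2), (j.choose p : ℤ_[p]) * evalOn W (localTowerPointsOfEmb κ ι W) z (g ^ j • c 2) -
        2 * ∑ j ∈ range p, (j : ℤ_[p]) * evalOn W (localTowerPointsOfEmb κ ι W) z (g ^ j • c 1) := by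
  have hle := fun n ↦ localLayerPointsOfEmb_le_localTowerPointsOfEmb κ ι W n
  have h2 : ∀ j : ℕ, g ^ j • c 2 ∈ localTowerPointsOfEmb κ ι W := fun j ↦
    smul_mem_localTowerPointsOfEmb κ ι W _ (hle 2 (hH.2.1 2))
  have h1 : ∀ j : ℕ, g ^ j • c 1 ∈ localTowerPointsOfEmb κ ι W := fun j ↦
    smul_mem_localTowerPointsOfEmb κ ι W _ (hle 1 (hH.2.1 1))
  set Q : localTowerPointsOfEmb κ ι W :=
    ∑ j ∈ range (p ^ 2), (j.choose p) • (⟨g ^ j • c 2, h2 j⟩ : localTowerPointsOfEmb κ ι W) -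
      2 • ∑ j ∈ range p, j • (⟨g ^ j • c 1, h1 j⟩ : localTowerPointsOfEmb κ ι W) with hQ
  have hQcoe : (Q : localPoints W E) =
      ∑ j ∈ range (p ^ 2), (j.choose p) • (g ^ j • c 2) - 2 • ∑ j ∈ range p, j • (g ^ j • c 1) := by
    rw [hQ, AddSubgroupClass.coe_sub, AddSubmonoidClass.coe_nsmul, AddSubmonoidClass.coe_finsetSum,
      AddSubmonoidClass.coe_finsetSum]
    simp only [AddSubmonoidClass.coe_nsmul]
  rw [← hQcoe, evalOn_of_mem W _ z Q.2, Subtype.coe_eta, hQ, map_sub, map_nsmul, map_sum, map_sum]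
  simp only [map_nsmul, nsmul_eq_mul, Nat.cast_ofNat]
  congr 1
  · exact sum_congr rfl fun j _ => by rw [evalOn_of_mem W _ z (h2 j)]
  · congr 1
    exact sum_congr rfl fun j _ => by rw [evalOn_of_mem W _ z (h1 j)]

/-- **`T·Λ² ⊆ Col(H¹_Iw(T))` from ONE point-independence clause** (any base `K`, any `ℤ_p`-extension, any place; `p ∣ a_p`,
`g` a local lift of the topological generator, `(c_{−1}, c)` a Honda system). HYPOTHESES beyond the Honda system: (i) the
tower `E(K_∞·K_v)` has no `p`-torsion (Lemma 2.3; a theorem over `ℚ`, `LocalTowerNoPTorsionProofs`); (ii) **the points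
`c_{−1}` and `q = ∑_{j<p²} C(j,p)·gʲc_2 − 2·∑_{j<p} j·gʲc_1` are `𝔽_p`-independent in `E(K_∞·K_v)/p`** — the residual INPUT:
it holds as soon as the Honda span at level `2` has `𝔽_p`-dimension `p²` modulo `p` (`Ê(𝔪_2)` free of rank `[ℚ_{p,2} : ℚ_p] =
p²`, Sprung Thm. 2.2 / Lemma 2.3: then `⟨c̄_2⟩ ≅ 𝔽_p[N]/N^{p²−p+1}`, `⟨c̄_1⟩ ≅ 𝔽_p[N]/N^p` glued along `c̄_{−1}`, `N = g − 1`,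
and `q̄ − 2c̄_{−1} = 2N^{p−2}c̄_1 − N^{p²−p−1}c̄_2` is a second socle vector), a RANK statement which the dual-form generation
clauses of `IsHondaSystem` do not supply. CONCLUSION: every `(T·x, T·y)` is a Coleman value (two-point separation §2 +
the criterion `IsColemanPair.forall_exists_isColemanPair_X_mul_of_det`). [cite: Sprung2012, Thm. 2.2, Lemma 2.3 (p. 1487), Def. 5.9 (p. 1495), §7.1 (pp. 1500–1501)]
[cite: KuriharaPollack2007, Prop. 1.2] [cite: LeiSujatha2021, §3 (SES-KP)] -/
theorem forall_exists_isColemanPair_X_mul_of_independent {ap : ℤ} (hap : (p : ℤ) ∣ ap)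
    {g : Field.absoluteGaloisGroup E} (hg : κ.IsTopGenerator (resGalOfEmb ι g)) {cneg : localPoints W E}
    {c : ℕ → localPoints W E} (hH : IsHondaSystem κ ι W ap g cneg c)
    (hN : ∀ P : localPoints W E, P ∈ localTowerPointsOfEmb κ ι W → p • P = 0 → P = 0)
    (hind : ∀ (m₀ m₁ : ℤ) (y : localPoints W E), y ∈ localTowerPointsOfEmb κ ι W →
      p • y = m₀ • cneg + m₁ • (∑ j ∈ range (p ^ 2), (j.choose p) • (g ^ j • c 2) - 2 • ∑ j ∈ range p, j • (g ^ j • c 1)) →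
      (p : ℤ) ∣ m₀ ∧ (p : ℤ) ∣ m₁) :
    ∀ x y : IwasawaAlgebra p, ∃ z : localTowerPointsOfEmb κ ι W →+ ℤ_[p],
      IsColemanPair κ ι W ap g c z (PowerSeries.X * x) (PowerSeries.X * y) := by
  have hle := fun n ↦ localLayerPointsOfEmb_le_localTowerPointsOfEmb κ ι W n
  set x₁ : localTowerPointsOfEmb κ ι W := ⟨cneg, hle 0 hH.1⟩ with hx₁
  set x₂ : localTowerPointsOfEmb κ ι W := ⟨_, honda_q_mem hH⟩ with hx₂
  have hN' : ∀ y : localTowerPointsOfEmb κ ι W, p • y = 0 → y = 0 := fun y hy ↦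
    Subtype.ext (hN y y.2 (by rw [← AddSubmonoidClass.coe_nsmul, hy]; rfl))
  have hind' : ∀ (m₁ m₂ : ℤ) (y : localTowerPointsOfEmb κ ι W), p • y = m₁ • x₁ + m₂ • x₂ →
      (p : ℤ) ∣ m₁ ∧ (p : ℤ) ∣ m₂ := fun m₁ m₂ y hy ↦
    hind m₁ m₂ y y.2 (by
      have h := congrArg (fun t : localTowerPointsOfEmb κ ι W ↦ (t : localPoints W E)) hy
      simpa only [AddSubmonoidClass.coe_nsmul, AddMemClass.coe_add, AddSubgroupClass.coe_zsmul] using h)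
  obtain ⟨z₀, z₁, hdet⟩ := exists_addMonoidHom_pair_det_not_dvd hN' hind'
  obtain ⟨α, β, h₀⟩ := exists_isColemanPair κ ι W hg hap hH z₀
  obtain ⟨a, b, h₁⟩ := exists_isColemanPair κ ι W hg hap hH z₁
  refine (h₀.forall_exists_isColemanPair_X_mul_of_det hap hg hH h₁ ?_).2
  rwa [← evalOn_honda_q hH z₀, ← evalOn_honda_q hH z₁, evalOn_of_mem W _ z₀ (hle 0 hH.1), evalOn_of_mem W _ z₁ (hle 0 hH.1),
    evalOn_of_mem W _ z₀ (honda_q_mem hH), evalOn_of_mem W _ z₁ (honda_q_mem hH)]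

end Cokernel

/-! ## §4 Over `ℚ` at an odd supersingular prime: the tower is `p`-torsion-free (Lemma 2.3), so only the independence
clause remains -/

section Rat

open NumberField IsDedekindDomain

/-- **(SES-KP), cokernel half, over `ℚ`** — `W/ℚ` elliptic globally minimal, `p ≠ 2` good supersingular (`p ∣ a_p`), any
`ℤ_p`-extension `κ`, `v ∋ p`, the chosen embedding, `g` a local lift of the topological generator, `(c_{−1}, c)` a Honda
system: IF `c_{−1}` and `q = ∑_{j<p²} C(j,p)·gʲc_2 − 2·∑_{j<p} j·gʲc_1` are `𝔽_p`-independent in `E(ℚ_∞·ℚ_p)/p` (the rank input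
of Thm. 2.2: `Ê(𝔪_2)` free of rank `p²`), THEN every `(T·x, T·y) ∈ T·Λ²` is a Coleman value `Col(z)`. Together with
`IsColemanPair.eq_zero_of_pair_zero` (injectivity) and `IsColemanPair.constantCoeff_eq` (image mod `T` = a line) this is the
exact sequence `0 → H¹_Iw(T) →^{Col} Λ² → ℤ_p → 0`: the cokernel of the joint Coleman map is `Λ/(T)`, of length `0` at
every height-one prime `𝔭 ≠ (T)` — the hypothesis `hcoker` of the F-α skeleton
`min_lengthAt_quotient_range_le_lengthAt_torsion_of_skeleton` (Summits, crux `KatoFineLowerSporadicX8`).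
[cite: Sprung2012, Thm. 2.2, Lemma 2.3 (p. 1487), Def. 5.9 (p. 1495), Def. 7.1–7.2, Props. 7.3/7.6 (pp. 1500–1501)]
[cite: KuriharaPollack2007, Prop. 1.2] [cite: LeiSujatha2021, §3 (SES-KP)] -/
theorem forall_exists_isColemanPair_X_mul_rat (W : WeierstrassCurve ℚ) [W.IsElliptic] [W.IsGloballyMinimal]
    (p : ℕ) [Fact p.Prime] (hp2 : p ≠ 2) (hgood : W.HasGoodReductionAtPrime p) (hap : (p : ℤ) ∣ W.frobeniusTrace p)
    (κ : ZpExtension ℚ p) {v : HeightOneSpectrum (𝓞 ℚ)} (hpv : (p : 𝓞 ℚ) ∈ v.asIdeal)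
    {g : Field.absoluteGaloisGroup (v.adicCompletion ℚ)}
    (hg : κ.IsTopGenerator (resGalOfEmb (closureEmb (K := ℚ) (v.adicCompletion ℚ)) g))
    {cneg : localPoints W (v.adicCompletion ℚ)} {c : ℕ → localPoints W (v.adicCompletion ℚ)}
    (hH : IsHondaSystem κ (closureEmb (K := ℚ) (v.adicCompletion ℚ)) W (W.frobeniusTrace p) g cneg c)
    (hind : ∀ (m₀ m₁ : ℤ) (y : localPoints W (v.adicCompletion ℚ)),
      y ∈ localTowerPointsOfEmb κ (closureEmb (K := ℚ) (v.adicCompletion ℚ)) W →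
      p • y = m₀ • cneg + m₁ • (∑ j ∈ range (p ^ 2), (j.choose p) • (g ^ j • c 2) - 2 • ∑ j ∈ range p, j • (g ^ j • c 1)) →
      (p : ℤ) ∣ m₀ ∧ (p : ℤ) ∣ m₁) :
    ∀ x y : IwasawaAlgebra p, ∃ z : localTowerPointsOfEmb κ (closureEmb (K := ℚ) (v.adicCompletion ℚ)) W →+ ℤ_[p],
      IsColemanPair κ (closureEmb (K := ℚ) (v.adicCompletion ℚ)) W (W.frobeniusTrace p) g c z
        (PowerSeries.X * x) (PowerSeries.X * y) :=
  forall_exists_isColemanPair_X_mul_of_independent hap hg hH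
    (fun _ hP hpP ↦ eq_zero_of_mem_localTowerPointsOfEmb_of_prime_nsmul W p hp2 hgood hap κ hpv _ hP hpP) hind

end Rat

/-! ## §5 The consumer's form: `T·Λ² ⊆ range J ⟹ ℓ_𝔭(Λ²/range J) = 0` off `(T)` -/

section Length

variable {p : ℕ} [Fact p.Prime]

/-- **`hcoker` of the F-α skeleton from the cokernel clause.** For ANY `Λ`-module `P` and `Λ`-linear
`J : P → Λ × Λ` whose range contains `T·Λ²` (e.g. `P = H¹_Iw(T)` in the functional model with `moduleOfGenerator`, `J` the
joint Coleman map, by `forall_exists_isColemanPair_X_mul_rat`), the cokernel `Λ²/range J` is killed by `T`, hence has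
length `0` at every prime `𝔭 ∌ T` — in particular at every height-one prime other than `(T)`: the sporadic primes and the
positive-level cyclotomic primes `(Φ_{pʲ}(1+T))`, `j ≥ 1`, of the x8 cruxes. [folklore]
[cite: KuriharaPollack2007, Prop. 1.2] [cite: LeiSujatha2021, §3 (SES-KP)] -/
theorem lengthAt_quotient_range_eq_zero_of_forall_X_mul {P : Type*} [AddCommGroup P] [Module (IwasawaAlgebra p) P]
    (J : P →ₗ[IwasawaAlgebra p] IwasawaAlgebra p × IwasawaAlgebra p)
    (hJ : ∀ x y : IwasawaAlgebra p, ∃ z : P, J z = (PowerSeries.X * x, PowerSeries.X * y))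
    (𝔭 : PrimeSpectrum (IwasawaAlgebra p)) (hT : (PowerSeries.X : IwasawaAlgebra p) ∉ 𝔭.asIdeal) :
    Module.lengthAt (IwasawaAlgebra p) ((IwasawaAlgebra p × IwasawaAlgebra p) ⧸ LinearMap.range J) 𝔭 = 0 := by
  refine Module.lengthAt_eq_zero_of_isTorsionBy (fun v ↦ ?_) 𝔭 hT
  obtain ⟨⟨x, y⟩, rfl⟩ := Submodule.Quotient.mk_surjective _ v
  rw [← Submodule.Quotient.mk_smul, Submodule.Quotient.mk_eq_zero]
  obtain ⟨z, hz⟩ := hJ x y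
  exact ⟨z, by rw [hz, Prod.smul_mk, smul_eq_mul, smul_eq_mul]⟩

end Length

end Literature.NumberTheory.EllipticCurves.Sprung2012

end
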